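import Literature.MathematicalPhysics.QuantumFieldTheory.Balaban1983to89.B9CubeBondRowAgreementNearH
import Literature.MathematicalPhysics.QuantumFieldTheory.Balaban1983to89.B9Eq340TaxiTelescope
import Literature.MathematicalPhysics.QuantumFieldTheory.Balaban1983to89.B13BondAveragingReadingNumerals

/-!
# `Balaban1983to89.B9Eq380CubeLetters` — T. Bałaban, *Propagators for lattice gauge theories in a background field*, Commun. Math. Phys. **99**
# (1985) 389–434 [Balaban1985BackgroundPropagators] (3.80)–(3.81) pp. 406–407 AT THE CUBE LETTERS `Q_□ ∕ Q*_□` of Sect. C p. 409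
# (`B9CubeLettersBondOpsL0.QCubeY ∕ QsCubeY`, def-Y's transporters `parBY`): `Q_□(U′U) = Q_□(U) + F₂`, `Q*_□(U′U) = Q*_□(U) + F₂*` with
# `|F₂|, |F₂*| ≦ O(1)·ρ` whenever the bond variables of `U′` are `ρ`-close to `1` around the averaging stencils (sub-row G-B9-LETTERS, slot M5.1b-Q)

statement-level skeleton of published theorems with citation tags; proofs where landed; nothing here is a claim about the Yang–Mills mass gap

THE PRINT (first-hand, `paper:balaban1985-cmp99-background-propagators` pp. 406–407 = PDF 18–19; the displays (3.78)–(3.81) are garbled on the text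
layer, their x4-render reading is recorded in `B9Eq380Telescope`'s docstring).  p. 406: *«Finally we consider the averaging operator Q(U). …»* (3.78) (the
product structure of `Q_j(U′U)`), *«From (3.78) it follows that Q_j(U′U) depends analytically on A in the above domain, and we have … Q_j(U′U) = Q_j(U) +
F_{2,j}(A), (3.80) where F_{2,j} is defined by the last equality. … The inequality (143) [5] implies the following bound … ≦ O(1)α₁ … on Λ_j (3.81) for
Mα₀, α₁ sufficiently small and with a constant O(1) depending on d and L only. We have a similar expansion for Q*_j(U′U), i.e. Q*_j(U′U) = Q*_j(U) +
F*_{2,j}(A), and F*_{2,j}(A) satisfies (3.81). (Let us notice that for complex configurations A the operator F*_{2,j}(A) is not the adjoint of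
F_{2,j}(A).)»*; p. 407 l.1–3: *«|F₂(A; y, x)|, |F₂*(A; x, y)| ≦ O(1)α₁»*.  (3.12)–(3.14) pp. 392–393: the averaging operator transports the fine bond
variable to the initial point of the coarse bond, `R(U(Γ))`, `R(V)X = VXV⁻¹`; (3.40) p. 397: *«Γ_{x,x′} is a shortest contour connecting points x and x′»*.

WHY THIS FILE (cell `lit-balaban`, sub-row G-B9-LETTERS of ROW G-B8-T2S, module-map slot **M5.1b-Q** «(3.80)–(3.81) at the cube letters», booked to
this seat by the map owner r06 g67 2026-08-28T09:00:44Z, `lit-balaban-r06/B9-LETTERS-MAP.md` §8).  The Sect.-B step (Thm 3.4 ∕ Cor. 3.5) for the cube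
operators `G_□(U)` of p. 409 — n06-c's contract `B9SectBGStepAtLetters.GFrame` fields `qb_mul` ∕ `hF₂`, consumed ×4 and instantiated ×0 (r06), and the
G-part of M5.1b (ym-inputs-p02) — needs (3.80)–(3.81) for the CONCRETE cube letters `Q_□(U) = QCubeY i q (parBY i) U`, `Q*_□(U) = QsCubeY i q (parBY i) U`
(r05 g77–g80, `B9CubeLettersBondOpsL0` :122 ∕ :125).  These letters transport the fine bond `b` to the base point `embIter j(y) y₋` of the index bond `y`
ALONG def-Y's TAXICAB CONTOUR (`Node00.parBY = parTaxiV`, one contour — not print's level-by-level iterated contours of (3.78)), so (3.81) follows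
here DIRECTLY from the telescoping of the contour variable of a product configuration, bond by bond, with every `O(1)` explicit — print's own road
((3.78) + (143) of [5] = Balaban1985Averaging) is cited, not reproduced (DECLARED READING).

WHAT IS PROVED (sorry-free; 0 `def`, 0 facts; `F₂ := Q_□(U′U) − Q_□(U)` is written out, (3.80) being its definition).
* §1 [folklore] units: `norm_R_sub_self_le_of_unitaryLike` (`‖R(u)X − X‖ ≤ 2‖u − 1‖‖X‖`, = `T4DirectionChart.GUnit.norm_transport_sub_self_le`),
  `norm_R_sub_R_le_of_unitaryLike` (`‖R(a)X − R(b)X‖ ≤ 2‖a − b‖‖X‖`), private `norm_inv_sub_inv_le_of_unitaryLike` (`‖a⁻¹ − b⁻¹‖ ≤ ‖a − b‖`) for unitary-like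
  units (`T4RelativeLadder.UnitaryLike`: `‖u‖, ‖u⁻¹‖ ≤ 1`).
* §2 THE CONTOUR VARIABLE OF A PRODUCT CONFIGURATION (any torus `P`, any normed ring with `‖1‖ = 1`): ★★ `norm_stepRun_mul_sub_le` — along any signed step
  path, `‖(U′U)(Γ) − U(Γ)‖ ≤ |Γ|·ρ` when `U, U′` are unitary-like and `‖U′(b) − 1‖ ≤ ρ` on the bonds `b` of `Γ` (`B9Eq340StepLasso.stepRun ∕ rungSites`,
  induction as in `B9Eq340TaxiTelescope.norm_gap_le_length_mul`); ★★ `norm_parTaxiV_mul_sub_le` — for def-Y's taxicab contour `Γ_{x,x′}`: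
  `‖(U′U)(Γ_{x,x′}) − U(Γ_{x,x′})‖ ≤ |x − x′|₁·ρ` when `‖U′(b) − 1‖ ≤ ρ` for the bonds sourced in the `ℓ^∞`-ball `{w : |x − w|_∞ ≤ |x − x′|_∞}`
  (`supDist_rungSites_taxiSteps_le`, `length_taxiSteps_eq_tdist` BY NAME).
* §3 THE TRANSPORTED LIFT IS LIPSCHITZ IN ITS TRANSPORTERS (any finite carriers): `trLiftY_sub_trLiftY_apply`, ★ `norm_trLiftY_sub_apply_le`
  (`‖(M♯_T Λ − M♯_{T′} Λ)(y)‖ ≤ Σ_x |M(y,x)|·2τ(x)·‖Λ(x)‖` when `‖T(y,x) − T′(y,x)‖ ≤ τ(x)` at unitary-like transporters on the support of the row).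
* §4 AT THE CUBE LETTERS: `exists_run_of_qKc_ne_zero`, ★ `tdist_of_qKc_ne_zero` ∕ `tdist_of_qsKc_ne_zero` (the averaging range `|embIter j(y) y₋ − b₋|₁ ≤
  (d+2)(L^{j(y)} − 1) ≤ (d+2)(L^k − 1)` — n10-w4's `B13BondAveragingReadingNumerals.tdist_embIter_runSite_le` BY NAME at the cube sequence's `qwt`),
  `qTc_parBY` (`rfl` dictionary), ★★ `norm_qTc_mul_sub_le` (the transporter of `Q_□` at `U′U` is `|Γ|·ρ`-close to the one at `U`), and the printed
  statements: ★★★ `norm_QCubeY_mul_sub_apply_le` — **(3.80)–(3.81) for `Q_□`**: `‖(Q_□(U′U)A − Q_□(U)A)(y)‖ ≤ 2·D·ρ·Σ_b |q^□_y(b)|·‖A(b)‖` for unitary-like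
  `U, U′` with `‖U′(b) − 1‖ ≤ ρ` on the bonds sourced within `ℓ^∞`-distance `D` of the base point of `y`, `D` any averaging-range bound (displayed binder
  `hDa`, n10's shape, DISCHARGED by `tdist_of_qKc_ne_zero_le`); ★★★ `norm_QsCubeY_mul_sub_apply_le` — **the same for `Q*_□`** (transporters inverted;
  «F₂* is not the adjoint of F₂» is respected: it is bounded on its own); the range-discharged forms ★★★ `norm_QCubeY_mul_sub_apply_le_range` ∕
  `norm_QsCubeY_mul_sub_apply_le_range` (`D = (d+2)(L^k − 1)`), the GLOBAL-smallness forms `…_of_forall` (`‖U′(b) − 1‖ ≤ ρ` everywhere), and the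
  BACKGROUND-`1` faces ★★★ `norm_QCubeY_sub_one_apply_le` ∕ `norm_QsCubeY_sub_one_apply_le` (`U = 1`: the instance of the cube road, where Cor. 3.6 p. 408
  has gauged the background to `1` on `□̃` and `U′ = U^u = e^{iηA′}` is (3.37)-small — `B9Cor36GaugeReductionCube.exists_gauge_small337_of_reg335Cube`).

HONEST SCOPE.  Finite lattice algebra and one induction along def-Y's contour; the smallness `‖U′(b) − 1‖ ≤ ρ` is a HYPOTHESIS (on the cube road it is
the bondwise face of p21's `Small337OnCube`, `‖e^{iηA′(b)} − 1‖ ≤ e^{α₁L^{−j}} − 1`, supplied by the consumer); print's `O(1)α₁` is here `2·D·ρ` with the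
averaging range `D` explicit; the row sums `Σ_b |q^□_y(b)|` are left as they are (the consumer's majorant currency absorbs them).  Nothing of [B9]'s
analysis ((3.78), [5] (143)) is asserted or used; count-neutral; NOT a node discharge; no summit ∕ sub-problem statement is proved; nothing continuum ∕
mass gap ∕ Clay.  Cell `lit-balaban`, seat `lit-balaban-r05` gen 81 (explicit-unit), 2026-08-28; `--supports stmt-QuantumFields-19200` as helper.  NEW file;
nothing landed is modified.  Net new unproved facts: 0.
-/

namespace Literature.MathematicalPhysics.QuantumFieldTheory.Balaban1983to89.B9Eq380CubeLetters

open LatticeFieldCalculus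
open Node00
open Literature.MathematicalPhysics.QuantumFieldTheory.Balaban1983to89.B9BackgroundsKLevelV1 (CfgV1)
open Literature.MathematicalPhysics.QuantumFieldTheory.Balaban1983to89.B9Eq39Adjoint (R R_def R_sub R_one)
open Literature.MathematicalPhysics.QuantumFieldTheory.Balaban1983to89.T4RelativeLadder (UnitaryLike norm_unit_mul_le norm_mul_unit_le)
open Literature.MathematicalPhysics.QuantumFieldTheory.Balaban1983to89.B9Eq340StepLasso (stepRun rungSites taxiSteps parTaxiV_eq_stepRun unitaryLike_stepRun)
open Literature.MathematicalPhysics.QuantumFieldTheory.Balaban1983to89.B9Eq340TaxiTelescope (norm_R_le length_taxiSteps_eq_tdist supDist_rungSites_taxiSteps_le)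
open Literature.MathematicalPhysics.QuantumFieldTheory.Balaban1983to89.B3TorusRadialSums (supDist_le_tdist)
open Literature.MathematicalPhysics.QuantumFieldTheory.Balaban1983to89.B5Eq118OneStroke (iterBlock)
open Literature.MathematicalPhysics.QuantumFieldTheory.Balaban1983to89.B6KLevelCensusIndexV1 (KIdx)
open Literature.MathematicalPhysics.QuantumFieldTheory.Balaban1983to89.B6Cover236MultiLevelBlocks (cubes)
open Literature.MathematicalPhysics.QuantumFieldTheory.Balaban1983to89.B6GlobalChartV1 (PV)
open Literature.MathematicalPhysics.QuantumFieldTheory.Balaban1983to89.B15DeterminingSets (embIter)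
open Literature.MathematicalPhysics.QuantumFieldTheory.Balaban1983to89.B9CubeLettersOpsL0 (cubeFamY)
open Literature.MathematicalPhysics.QuantumFieldTheory.Balaban1983to89.B9CubeLettersBondOpsL0 (IBondCubeY qKc qsKc qTc QCubeY QsCubeY)
open Literature.MathematicalPhysics.QuantumFieldTheory.Balaban1983to89.B9CubeLettersCovarianceL0 (qsKc_eq_transpose)
open Literature.MathematicalPhysics.QuantumFieldTheory.Balaban1983to89.B9CubeBondRowAgreementNearH (qKc_apply')
open Literature.MathematicalPhysics.QuantumFieldTheory.Balaban1983to89.B13BondAveragingReadingNumerals (tdist_embIter_runSite_le)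
open scoped Matrix

noncomputable section

/-! ## §1 Units near `1` ([folklore] normed-ring bookkeeping) -/

section Units

variable {𝔸 : Type} [NormedRing 𝔸]

/-- `‖R(u)X − X‖ ≤ 2‖u − 1‖·‖X‖` for a unitary-like `u` (`T4DirectionChart.GUnit.norm_transport_sub_self_le`, by name: `R u X` and `transport u X`
are the same word `uXu⁻¹`). [cite: Balaban1985BackgroundPropagators, (3.3) p.390 («R(U)X = UXU⁻¹»), folklore] -/
theorem norm_R_sub_self_le_of_unitaryLike {u : 𝔸ˣ} (hu : UnitaryLike u) (X : 𝔸) : ‖R u X - X‖ ≤ 2 * ‖(u : 𝔸) - 1‖ * ‖X‖ :=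
  T4DirectionChart.GUnit.norm_transport_sub_self_le hu X

/-- `‖a⁻¹ − b⁻¹‖ ≤ ‖a − b‖` for unitary-like units (`a⁻¹ − b⁻¹ = a⁻¹(b − a)b⁻¹`; private [folklore] helper for the `Q*_□` transporters).
[cite: Balaban1985BackgroundPropagators, (3.13) p.392 (the inverted transporter of Q*), folklore] -/
private theorem norm_inv_sub_inv_le_of_unitaryLike {a b : 𝔸ˣ} (ha : UnitaryLike a) (hb : UnitaryLike b) :
    ‖((a⁻¹ : 𝔸ˣ) : 𝔸) - ((b⁻¹ : 𝔸ˣ) : 𝔸)‖ ≤ ‖(a : 𝔸) - b‖ := by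
  have e : ((a⁻¹ : 𝔸ˣ) : 𝔸) - ((b⁻¹ : 𝔸ˣ) : 𝔸) = ((a⁻¹ : 𝔸ˣ) : 𝔸) * ((b : 𝔸) - a) * ((b⁻¹ : 𝔸ˣ) : 𝔸) := by
    rw [mul_sub, sub_mul, Units.mul_inv_cancel_right, Units.inv_mul, one_mul]
  rw [e]
  calc ‖((a⁻¹ : 𝔸ˣ) : 𝔸) * ((b : 𝔸) - a) * ((b⁻¹ : 𝔸ˣ) : 𝔸)‖ ≤ ‖((a⁻¹ : 𝔸ˣ) : 𝔸) * ((b : 𝔸) - a)‖ := norm_mul_unit_le hb.inv _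
    _ ≤ ‖(b : 𝔸) - a‖ := norm_unit_mul_le ha.inv _
    _ = ‖(a : 𝔸) - b‖ := norm_sub_rev _ _

/-- `‖R(a)X − R(b)X‖ ≤ 2‖a − b‖·‖X‖` for unitary-like units (`R(a)X − R(b)X = R(b)(R(b⁻¹a)X − X)`, `‖b⁻¹a − 1‖ ≤ ‖a − b‖`).
[cite: Balaban1985BackgroundPropagators, (3.3) p.390, folklore] -/
theorem norm_R_sub_R_le_of_unitaryLike {a b : 𝔸ˣ} (ha : UnitaryLike a) (hb : UnitaryLike b) (X : 𝔸) :
    ‖R a X - R b X‖ ≤ 2 * ‖(a : 𝔸) - b‖ * ‖X‖ := by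
  have e : R a X - R b X = R b (R (b⁻¹ * a) X - X) := by
    rw [R_sub, ← B9Eq39Adjoint.R_mul, mul_inv_cancel_left]
  have hn : ‖((b⁻¹ * a : 𝔸ˣ) : 𝔸) - 1‖ ≤ ‖(a : 𝔸) - b‖ := by
    have e2 : ((b⁻¹ * a : 𝔸ˣ) : 𝔸) - 1 = ((b⁻¹ : 𝔸ˣ) : 𝔸) * ((a : 𝔸) - b) := by
      rw [Units.val_mul, mul_sub, Units.inv_mul]
    rw [e2]
    exact norm_unit_mul_le hb.inv _
  rw [e]
  calc ‖R b (R (b⁻¹ * a) X - X)‖ ≤ ‖R (b⁻¹ * a) X - X‖ := norm_R_le hb _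
    _ ≤ 2 * ‖((b⁻¹ * a : 𝔸ˣ) : 𝔸) - 1‖ * ‖X‖ := norm_R_sub_self_le_of_unitaryLike (hb.inv.mul ha) X
    _ ≤ 2 * ‖(a : 𝔸) - b‖ * ‖X‖ := by gcongr

end Units

/-! ## §2 The contour variable of a product configuration: `‖(U′U)(Γ) − U(Γ)‖ ≤ |Γ|·ρ` -/

section Contour

variable {P : Params} {𝔸 : Type} [NormedRing 𝔸] [NormOneClass 𝔸]

/-- ★★ **ALONG ANY SIGNED STEP PATH**: for unitary-like `U, U′` and `‖U′(b) − 1‖ ≤ ρ` on the bonds of the path (`rungSites`: the source of each bond met,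
forward or backward), the path variables of the product configuration `U′U` and of `U` differ by at most `|Γ|·ρ` — one bond at a time:
`(U′U)(b)S₁ − U(b)S₂ = (U′(b) − 1)U(b)S₁ + U(b)(S₁ − S₂)`, `((U′U)(b))⁻¹S₁ − U(b)⁻¹S₂ = U(b)⁻¹((U′(b)⁻¹ − 1)S₁ + (S₁ − S₂))`.
[cite: Balaban1985BackgroundPropagators, (3.80)–(3.81) p.406, (3.40) p.397, (3.3) p.391] -/
theorem norm_stepRun_mul_sub_le {U V : CfgV1 P 𝔸} (hU : ∀ μ x, UnitaryLike (U μ x)) (hV : ∀ μ x, UnitaryLike (V μ x)) {ρ : ℝ} (hρ : 0 ≤ ρ) :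
    ∀ (l : List (Fin P.d × Bool)) (w : Site P 0), (∀ r ∈ rungSites l w, ‖(V r.2.1 r.1 : 𝔸) - 1‖ ≤ ρ) →
      ‖(stepRun (fun μ x => V μ x * U μ x) l w : 𝔸) - (stepRun U l w : 𝔸)‖ ≤ l.length * ρ
  | [], w, _ => by simp [stepRun]
  | (ν, true) :: l, w, h => by
    have hVU : ∀ μ x, UnitaryLike (V μ x * U μ x) := fun μ x => (hV μ x).mul (hU μ x)
    have hw : ‖(V ν w : 𝔸) - 1‖ ≤ ρ := h (w, ν, true) (by simp [rungSites])
    have ih := norm_stepRun_mul_sub_le hU hV hρ l (w.shift ν) fun r hr => h r (by simp [rungSites, hr])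
    simp only [stepRun, Units.val_mul, List.length_cons, Nat.cast_succ]
    set S₁ : 𝔸 := (stepRun (fun μ x => V μ x * U μ x) l (w.shift ν) : 𝔸)
    set S₂ : 𝔸 := (stepRun U l (w.shift ν) : 𝔸)
    have e : (V ν w : 𝔸) * (U ν w : 𝔸) * S₁ - (U ν w : 𝔸) * S₂ =
        ((V ν w : 𝔸) - 1) * ((U ν w : 𝔸) * S₁) + (U ν w : 𝔸) * (S₁ - S₂) := by noncomm_ring
    rw [e]
    have h1 : ‖((V ν w : 𝔸) - 1) * ((U ν w : 𝔸) * S₁)‖ ≤ ρ := by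
      have hS : ‖(U ν w : 𝔸) * S₁‖ ≤ 1 := by
        have hu := ((hU ν w).mul (unitaryLike_stepRun hVU l (w.shift ν))).1
        simpa [S₁] using hu
      calc ‖((V ν w : 𝔸) - 1) * ((U ν w : 𝔸) * S₁)‖ ≤ ‖(V ν w : 𝔸) - 1‖ * ‖(U ν w : 𝔸) * S₁‖ := norm_mul_le _ _
        _ ≤ ρ * 1 := mul_le_mul hw hS (norm_nonneg _) hρ
        _ = ρ := mul_one ρ
    have h2 : ‖(U ν w : 𝔸) * (S₁ - S₂)‖ ≤ l.length * ρ := (norm_unit_mul_le (hU ν w) _).trans ih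
    calc _ ≤ ‖((V ν w : 𝔸) - 1) * ((U ν w : 𝔸) * S₁)‖ + ‖(U ν w : 𝔸) * (S₁ - S₂)‖ := norm_add_le _ _
      _ ≤ ρ + l.length * ρ := add_le_add h1 h2
      _ = (l.length + 1) * ρ := by ring
  | (ν, false) :: l, w, h => by
    have hVU : ∀ μ x, UnitaryLike (V μ x * U μ x) := fun μ x => (hV μ x).mul (hU μ x)
    have hw : ‖(V ν (w.unshift ν) : 𝔸) - 1‖ ≤ ρ := h (w.unshift ν, ν, false) (by simp [rungSites])
    have ih := norm_stepRun_mul_sub_le hU hV hρ l (w.unshift ν) fun r hr => h r (by simp [rungSites, hr])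
    simp only [stepRun, mul_inv_rev, Units.val_mul, List.length_cons, Nat.cast_succ]
    set S₁ : 𝔸 := (stepRun (fun μ x => V μ x * U μ x) l (w.unshift ν) : 𝔸)
    set S₂ : 𝔸 := (stepRun U l (w.unshift ν) : 𝔸)
    set u : 𝔸ˣ := U ν (w.unshift ν)
    set v : 𝔸ˣ := V ν (w.unshift ν)
    have e : ((u⁻¹ : 𝔸ˣ) : 𝔸) * ((v⁻¹ : 𝔸ˣ) : 𝔸) * S₁ - ((u⁻¹ : 𝔸ˣ) : 𝔸) * S₂ =
        ((u⁻¹ : 𝔸ˣ) : 𝔸) * ((((v⁻¹ : 𝔸ˣ) : 𝔸) - 1) * S₁ + (S₁ - S₂)) := by noncomm_ring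
    rw [e]
    have hv : ‖((v⁻¹ : 𝔸ˣ) : 𝔸) - 1‖ ≤ ρ := (T4DirectionChart.GUnit.norm_inv_sub_one_le (hV ν _)).trans hw
    have hS : ‖S₁‖ ≤ 1 := by
      have hu := (unitaryLike_stepRun hVU l (w.unshift ν)).1
      simpa [S₁] using hu
    calc ‖((u⁻¹ : 𝔸ˣ) : 𝔸) * ((((v⁻¹ : 𝔸ˣ) : 𝔸) - 1) * S₁ + (S₁ - S₂))‖ ≤ ‖(((v⁻¹ : 𝔸ˣ) : 𝔸) - 1) * S₁ + (S₁ - S₂)‖ :=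
          norm_unit_mul_le (hU ν _).inv _
      _ ≤ ‖(((v⁻¹ : 𝔸ˣ) : 𝔸) - 1) * S₁‖ + ‖S₁ - S₂‖ := norm_add_le _ _
      _ ≤ ρ * 1 + l.length * ρ := add_le_add ((norm_mul_le _ _).trans (mul_le_mul hv hS (norm_nonneg _) hρ)) ih
      _ = (l.length + 1) * ρ := by ring

/-- a contour variable of unitary-like bond variables is unitary-like (def-Y's taxicab contour read as a signed step run, `B9Eq340StepLasso`).
[cite: Balaban1985BackgroundPropagators, (3.40) p.397, bookkeeping] -/
theorem unitaryLike_parTaxiV' {U : CfgV1 P 𝔸} (hU : ∀ μ x, UnitaryLike (U μ x)) (x z : Site P 0) : UnitaryLike (parTaxiV U x z) := by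
  rw [parTaxiV_eq_stepRun]
  exact unitaryLike_stepRun hU _ _

/-- ★★ **THE TAXICAB CONTOUR VARIABLE OF A PRODUCT CONFIGURATION**: for unitary-like `U, U′` and `‖U′(b) − 1‖ ≤ ρ` on every bond whose source `w` has
`|x − w|_∞ ≤ |x − x′|_∞` (the contour stays that close to its start, `supDist_rungSites_taxiSteps_le`), `‖(U′U)(Γ_{x,x′}) − U(Γ_{x,x′})‖ ≤ |x − x′|₁·ρ`
(`|Γ_{x,x′}| = |x − x′|₁`, `length_taxiSteps_eq_tdist`). [cite: Balaban1985BackgroundPropagators, (3.80)–(3.81) p.406, (3.40) p.397] -/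
theorem norm_parTaxiV_mul_sub_le {U V : CfgV1 P 𝔸} (hU : ∀ μ x, UnitaryLike (U μ x)) (hV : ∀ μ x, UnitaryLike (V μ x)) {ρ : ℝ} (hρ : 0 ≤ ρ)
    (x z : Site P 0) (h : ∀ (ν : Fin P.d) (w : Site P 0), supDist x w ≤ supDist x z → ‖(V ν w : 𝔸) - 1‖ ≤ ρ) :
    ‖(parTaxiV (fun μ y => V μ y * U μ y) x z : 𝔸) - (parTaxiV U x z : 𝔸)‖ ≤ Site.tdist x z * ρ := by
  have h1 := norm_stepRun_mul_sub_le hU hV hρ (taxiSteps (List.finRange P.d) x z) x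
    fun r hr => h r.2.1 r.1 (supDist_rungSites_taxiSteps_le x z r hr).1
  rwa [length_taxiSteps_eq_tdist, ← parTaxiV_eq_stepRun, ← parTaxiV_eq_stepRun] at h1

end Contour

/-! ## §3 The transported lift `M♯_T` is Lipschitz in its transporters -/

section Lift

variable {𝔸 : Type} [NormedRing 𝔸] [NormedAlgebra ℂ 𝔸] [CompleteSpace 𝔸]
variable {X Y : Type} [Fintype X] [Fintype Y]

omit [Fintype Y] [CompleteSpace 𝔸] in
/-- `(M♯_T Λ − M♯_{T′} Λ)(y) = Σ_x M(y,x)·(R(T(y,x))Λ(x) − R(T′(y,x))Λ(x))`. [cite: Balaban1985BackgroundPropagators, (3.12) p.392, (3.80) p.406, bookkeeping] -/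
theorem trLiftY_sub_trLiftY_apply (M : Matrix Y X ℝ) (T T' : Y → X → 𝔸ˣ) (Λ : X → 𝔸) (y : Y) :
    (trLiftY M T Λ - trLiftY M T' Λ) y = ∑ x, ((M y x : ℝ) : ℂ) • (R (T y x) (Λ x) - R (T' y x) (Λ x)) := by
  simp only [Pi.sub_apply, trLiftY_apply, ← Finset.sum_sub_distrib, smul_sub]

omit [Fintype Y] [CompleteSpace 𝔸] in
/-- ★ **`M♯_T` IS LIPSCHITZ IN THE TRANSPORTERS**: if on the support of the row `M(y, ·)` the transporters `T(y,x), T′(y,x)` are unitary-like and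
`‖T(y,x) − T′(y,x)‖ ≤ τ(x)`, then `‖(M♯_T Λ − M♯_{T′} Λ)(y)‖ ≤ Σ_x |M(y,x)|·2τ(x)·‖Λ(x)‖`.
[cite: Balaban1985BackgroundPropagators, (3.80)–(3.81) p.406, (3.12) p.392] -/
theorem norm_trLiftY_sub_apply_le (M : Matrix Y X ℝ) (T T' : Y → X → 𝔸ˣ) (Λ : X → 𝔸) (y : Y) {τ : X → ℝ}
    (hT : ∀ x, M y x ≠ 0 → UnitaryLike (T y x)) (hT' : ∀ x, M y x ≠ 0 → UnitaryLike (T' y x))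
    (hτ : ∀ x, M y x ≠ 0 → ‖(T y x : 𝔸) - T' y x‖ ≤ τ x) :
    ‖(trLiftY M T Λ - trLiftY M T' Λ) y‖ ≤ ∑ x, |M y x| * (2 * τ x * ‖Λ x‖) := by
  rw [trLiftY_sub_trLiftY_apply]
  refine (norm_sum_le _ _).trans (Finset.sum_le_sum fun x _ => ?_)
  by_cases hx : M y x = 0
  · simp [hx]
  · rw [norm_smul, Complex.norm_real, Real.norm_eq_abs]
    refine mul_le_mul_of_nonneg_left ?_ (abs_nonneg _)
    calc ‖R (T y x) (Λ x) - R (T' y x) (Λ x)‖ ≤ 2 * ‖(T y x : 𝔸) - T' y x‖ * ‖Λ x‖ :=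
          norm_R_sub_R_le_of_unitaryLike (hT x hx) (hT' x hx) _
      _ ≤ 2 * τ x * ‖Λ x‖ := by gcongr; exact hτ x hx

end Lift

/-! ## §4 (3.80)–(3.81) at the cube letters `Q_□ ∕ Q*_□` -/

section Cube

variable {d ℓ : ℕ} {hd : 1 ≤ d + 1} {hL : Odd (ℓ + 1) ∧ 1 < ℓ + 1} {b₀ b₁ : ℝ}
variable {𝔸 : Type} [NormedRing 𝔸] [NormedAlgebra ℂ 𝔸] [CompleteSpace 𝔸]
variable (i : KIdx d ℓ hd hL b₀ b₁) (q : ↥(cubes (toKT i).D.toDomains))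

/-- **THE SUPPORT OF `q^□_y(·)`** ([3] (1.18) for the cube sequence): `q^□_y(f) ≠ 0 ⟹ f = [x + te_μ, x + (t+1)e_μ]`, `x ∈ B^{j(y)}(y₋)`, `t < L^{j(y)}`, `μ` the
direction of `y` (`B6Ineq2142KLevelV1L0.exists_of_qwt_ne_zero` BY NAME). [cite: Balaban1984PropagatorsI, (1.18) p.20; Balaban1985BackgroundPropagators, (3.12) p.392, p.409 l.3–5] -/
theorem exists_run_of_qKc_ne_zero {ι : IBondCubeY i q} {f : FBondY i} (h : qKc i q ι f ≠ 0) :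
    ∃ x ∈ iterBlock (ι.1.1 : ℕ) ι.1.2.src, ∃ t < (ℓ + 1) ^ (ι.1.1 : ℕ), runBond x ι.1.2.dir t = f := by
  rw [qKc_apply'] at h
  exact B6Ineq2142KLevelV1L0.exists_of_qwt_ne_zero i.hN (cubeFamY i q) i.hk ι h

/-- ★ **THE AVERAGING RANGE, LEVEL-SHARP**: `q^□_y(b) ≠ 0 ⟹ |embIter j(y) y₋ − b₋|₁ ≤ (d+2)(L^{j(y)} − 1)` (n10-w4's `tdist_embIter_runSite_le` BY NAME).
[cite: Balaban1984PropagatorsI, (1.18) p.20; Balaban1985BackgroundPropagators, (3.12) p.392, p.409 l.3–5] -/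
theorem tdist_of_qKc_ne_zero {ι : IBondCubeY i q} {b : FBondY i} (h : qKc i q ι b ≠ 0) :
    Site.tdist (embIter (ι.1.1 : ℕ) ι.1.2.src) b.src ≤ (d + 2) * ((ℓ + 1) ^ (ι.1.1 : ℕ) - 1) := by
  obtain ⟨x, hx, t, ht, rfl⟩ := exists_run_of_qKc_ne_zero i q h
  have hjm : (ι.1.1 : ℕ) ≤ i.m + i.K := (Nat.lt_succ_iff.1 ι.1.1.2).trans i.hk
  exact tdist_embIter_runSite_le (P := PV d ℓ i.m i.K hd hL) hjm hx ι.1.2.dir ht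

/-- ★ **THE AVERAGING RANGE, UNIFORM**: `q^□_y(b) ≠ 0 ⟹ |embIter j(y) y₋ − b₋|₁ ≤ (d+2)(L^k − 1)` (`j(y) ≤ k`) — n10's binder `hD` for the cube letters.
[cite: Balaban1984PropagatorsI, (1.18) p.20; Balaban1985BackgroundPropagators, (3.12) p.392, p.409 l.3–5] -/
theorem tdist_of_qKc_ne_zero_le : ∀ (ι : IBondCubeY i q) (b : FBondY i), qKc i q ι b ≠ 0 →
    Site.tdist (embIter (ι.1.1 : ℕ) ι.1.2.src) b.src ≤ (d + 2) * ((ℓ + 1) ^ i.k - 1) :=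
  fun ι _ h => (tdist_of_qKc_ne_zero i q h).trans
    (Nat.mul_le_mul_left _ (Nat.sub_le_sub_right (Nat.pow_le_pow_right (Nat.succ_pos ℓ) (Nat.lt_succ_iff.1 ι.1.1.2)) 1))

/-- … and for `Q*_□` (its kernel is the transpose, `B9CubeLettersCovarianceL0.qsKc_eq_transpose`): `q^{□*}(b, y) ≠ 0 ⟹ |embIter j(y) y₋ − b₋|₁ ≤ (d+2)(L^k − 1)`.
[cite: Balaban1985BackgroundPropagators, (3.13) p.392, p.409 l.3–5; Balaban1984PropagatorsI, (1.18) p.20] -/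
theorem tdist_of_qsKc_ne_zero_le : ∀ (b : FBondY i) (ι : IBondCubeY i q), qsKc i q b ι ≠ 0 →
    Site.tdist (embIter (ι.1.1 : ℕ) ι.1.2.src) b.src ≤ (d + 2) * ((ℓ + 1) ^ i.k - 1) := by
  intro b ι h
  rw [qsKc_eq_transpose, Matrix.transpose_apply] at h
  exact tdist_of_qKc_ne_zero_le i q ι b h

/-- `rfl` dictionary: the transporter of `Q_□(U)` at `(y, b)` IS def-Y's taxicab contour variable `U(Γ_{embIter j(y) y₋, b₋})`.
[cite: Balaban1985BackgroundPropagators, (3.12)–(3.14) pp.392–393, (3.40) p.397, dictionary] -/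
theorem qTc_parBY (U : CfgY 𝔸 i) (ι : IBondCubeY i q) (b : FBondY i) :
    qTc i q (parBY i) U ι b = parTaxiV U (embIter (ι.1.1 : ℕ) ι.1.2.src) b.src := rfl

variable [NormOneClass 𝔸]

/-- the transporters of `Q_□(U)` are unitary-like for unitary-like `U`. [cite: Balaban1985BackgroundPropagators, (3.12) p.392, (3.40) p.397, bookkeeping] -/
theorem unitaryLike_qTc_parBY {U : CfgY 𝔸 i} (hU : ∀ μ x, UnitaryLike (U μ x)) (ι : IBondCubeY i q) (b : FBondY i) :
    UnitaryLike (qTc i q (parBY i) U ι b) :=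
  unitaryLike_parTaxiV' hU _ _

/-- ★★ **THE TRANSPORTER OF `Q_□` AT `U′U` IS CLOSE TO THE ONE AT `U`**: `‖(U′U)(Γ_{y,b}) − U(Γ_{y,b})‖ ≤ |Γ_{y,b}|·ρ` when `‖U′ − 1‖ ≤ ρ` on the bonds sourced
in the `ℓ^∞`-ball around the base point of `y` through `b₋`. [cite: Balaban1985BackgroundPropagators, (3.80)–(3.81) p.406, (3.12) p.392, (3.40) p.397] -/
theorem norm_qTc_mul_sub_le {U V : CfgY 𝔸 i} (hU : ∀ μ x, UnitaryLike (U μ x)) (hV : ∀ μ x, UnitaryLike (V μ x)) {ρ : ℝ} (hρ : 0 ≤ ρ)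
    (ι : IBondCubeY i q) (b : FBondY i)
    (h : ∀ (ν : Fin (d + 1)) (w : Site (PV d ℓ i.m i.K hd hL) 0), supDist (embIter (ι.1.1 : ℕ) ι.1.2.src) w ≤ supDist (embIter (ι.1.1 : ℕ) ι.1.2.src) b.src →
      ‖(V ν w : 𝔸) - 1‖ ≤ ρ) :
    ‖(qTc i q (parBY i) (fun μ x => V μ x * U μ x) ι b : 𝔸) - (qTc i q (parBY i) U ι b : 𝔸)‖ ≤ Site.tdist (embIter (ι.1.1 : ℕ) ι.1.2.src) b.src * ρ :=
  norm_parTaxiV_mul_sub_le hU hV hρ _ _ h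

/-- ★★★ **(3.80)–(3.81) FOR `Q_□`, POINTWISE**: for unitary-like `U, U′`, an averaging-range bound `D` (`q^□_y(b) ≠ 0 ⟹ |embIter j(y) y₋ − b₋|₁ ≤ D`;
`tdist_of_qKc_ne_zero_le`), and `‖U′(b′) − 1‖ ≤ ρ` for every bond `b′` sourced within `ℓ^∞`-distance `D` of the base point of `y`:
`‖(Q_□(U′U)A − Q_□(U)A)(y)‖ ≤ 2·D·ρ · Σ_b |q^□_y(b)|·‖A(b)‖` — print's `|F₂(A; y, ·)| ≦ O(1)α₁` with `F₂ := Q_□(U′U) − Q_□(U)` and `O(1)α₁ = 2Dρ`.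
[cite: Balaban1985BackgroundPropagators, (3.80)–(3.81) pp.406–407, (3.12)–(3.14) pp.392–393, p.409 l.3–5] -/
theorem norm_QCubeY_mul_sub_apply_le {U V : CfgY 𝔸 i} (hU : ∀ μ x, UnitaryLike (U μ x)) (hV : ∀ μ x, UnitaryLike (V μ x)) {ρ : ℝ} (hρ : 0 ≤ ρ)
    {Da : ℕ} (hDa : ∀ (ι : IBondCubeY i q) (b : FBondY i), qKc i q ι b ≠ 0 → Site.tdist (embIter (ι.1.1 : ℕ) ι.1.2.src) b.src ≤ Da)
    (ι : IBondCubeY i q)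
    (hsmall : ∀ (ν : Fin (d + 1)) (w : Site (PV d ℓ i.m i.K hd hL) 0), supDist (embIter (ι.1.1 : ℕ) ι.1.2.src) w ≤ Da → ‖(V ν w : 𝔸) - 1‖ ≤ ρ)
    (A : FBondY i → 𝔸) :
    ‖(QCubeY i q (parBY i) (fun μ x => V μ x * U μ x) A - QCubeY i q (parBY i) U A) ι‖ ≤ 2 * Da * ρ * ∑ b, |qKc i q ι b| * ‖A b‖ := by
  have h := norm_trLiftY_sub_apply_le (qKc i q) (qTc i q (parBY i) (fun μ x => V μ x * U μ x)) (qTc i q (parBY i) U) A ι (τ := fun _ => Da * ρ)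
    (fun b _ => unitaryLike_qTc_parBY i q (fun μ x => (hV μ x).mul (hU μ x)) ι b) (fun b _ => unitaryLike_qTc_parBY i q hU ι b)
    (fun b hb => by
      have hD := hDa ι b hb
      refine (norm_qTc_mul_sub_le i q hU hV hρ ι b fun ν w hw => hsmall ν w ?_).trans ?_
      · exact hw.trans ((supDist_le_tdist _ _).trans hD)
      · exact mul_le_mul_of_nonneg_right (by exact_mod_cast hD) hρ)
  refine h.trans (le_of_eq ?_)
  rw [Finset.mul_sum]
  refine Finset.sum_congr rfl fun b _ => ?_
  ring

/-- ★★★ **(3.80)–(3.81) FOR `Q*_□`, POINTWISE** (transporters inverted; «F₂* is not the adjoint of F₂» — it is bounded on its own): under the same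
hypotheses, with the smallness around the base point of every index bond `y` whose stencil sees `b`:
`‖(Q*_□(U′U)B − Q*_□(U)B)(b)‖ ≤ 2·D·ρ · Σ_y |q^{□*}(b, y)|·‖B(y)‖`. [cite: Balaban1985BackgroundPropagators, (3.80)–(3.81) pp.406–407, (3.13) p.392, p.409 l.3–5] -/
theorem norm_QsCubeY_mul_sub_apply_le {U V : CfgY 𝔸 i} (hU : ∀ μ x, UnitaryLike (U μ x)) (hV : ∀ μ x, UnitaryLike (V μ x)) {ρ : ℝ} (hρ : 0 ≤ ρ)
    {Da : ℕ} (hDa : ∀ (ι : IBondCubeY i q) (b : FBondY i), qKc i q ι b ≠ 0 → Site.tdist (embIter (ι.1.1 : ℕ) ι.1.2.src) b.src ≤ Da)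
    (b : FBondY i)
    (hsmall : ∀ ι : IBondCubeY i q, qsKc i q b ι ≠ 0 → ∀ (ν : Fin (d + 1)) (w : Site (PV d ℓ i.m i.K hd hL) 0),
      supDist (embIter (ι.1.1 : ℕ) ι.1.2.src) w ≤ Da → ‖(V ν w : 𝔸) - 1‖ ≤ ρ)
    (B : IBondCubeY i q → 𝔸) :
    ‖(QsCubeY i q (parBY i) (fun μ x => V μ x * U μ x) B - QsCubeY i q (parBY i) U B) b‖ ≤ 2 * Da * ρ * ∑ ι, |qsKc i q b ι| * ‖B ι‖ := by
  have hVU : ∀ μ x, UnitaryLike (V μ x * U μ x) := fun μ x => (hV μ x).mul (hU μ x)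
  have h := norm_trLiftY_sub_apply_le (qsKc i q) (fun b ι => (qTc i q (parBY i) (fun μ x => V μ x * U μ x) ι b)⁻¹)
    (fun b ι => (qTc i q (parBY i) U ι b)⁻¹) B b (τ := fun _ => Da * ρ)
    (fun ι _ => (unitaryLike_qTc_parBY i q hVU ι b).inv) (fun ι _ => (unitaryLike_qTc_parBY i q hU ι b).inv)
    (fun ι hι => by
      have hι' : qKc i q ι b ≠ 0 := by rwa [qsKc_eq_transpose, Matrix.transpose_apply] at hι
      have hD := hDa ι b hι'
      refine (norm_inv_sub_inv_le_of_unitaryLike (unitaryLike_qTc_parBY i q hVU ι b) (unitaryLike_qTc_parBY i q hU ι b)).trans ?_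
      refine (norm_qTc_mul_sub_le i q hU hV hρ ι b fun ν w hw => hsmall ι hι ν w ?_).trans ?_
      · exact hw.trans ((supDist_le_tdist _ _).trans hD)
      · exact mul_le_mul_of_nonneg_right (by exact_mod_cast hD) hρ)
  refine h.trans (le_of_eq ?_)
  rw [Finset.mul_sum]
  refine Finset.sum_congr rfl fun ι _ => ?_
  ring

/-- ★★★ **(3.81) FOR `Q_□` WITH THE RANGE DISCHARGED**: `D = (d+2)(L^k − 1)` (`tdist_of_qKc_ne_zero_le`).
[cite: Balaban1985BackgroundPropagators, (3.80)–(3.81) pp.406–407, p.409 l.3–5; Balaban1984PropagatorsI, (1.18) p.20] -/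
theorem norm_QCubeY_mul_sub_apply_le_range {U V : CfgY 𝔸 i} (hU : ∀ μ x, UnitaryLike (U μ x)) (hV : ∀ μ x, UnitaryLike (V μ x)) {ρ : ℝ} (hρ : 0 ≤ ρ)
    (ι : IBondCubeY i q)
    (hsmall : ∀ (ν : Fin (d + 1)) (w : Site (PV d ℓ i.m i.K hd hL) 0),
      supDist (embIter (ι.1.1 : ℕ) ι.1.2.src) w ≤ (d + 2) * ((ℓ + 1) ^ i.k - 1) → ‖(V ν w : 𝔸) - 1‖ ≤ ρ)
    (A : FBondY i → 𝔸) :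
    ‖(QCubeY i q (parBY i) (fun μ x => V μ x * U μ x) A - QCubeY i q (parBY i) U A) ι‖ ≤
      2 * (((d + 2) * ((ℓ + 1) ^ i.k - 1) : ℕ) : ℝ) * ρ * ∑ b, |qKc i q ι b| * ‖A b‖ :=
  norm_QCubeY_mul_sub_apply_le i q hU hV hρ (tdist_of_qKc_ne_zero_le i q) ι hsmall A

/-- ★★★ **(3.81) FOR `Q*_□` WITH THE RANGE DISCHARGED**: `D = (d+2)(L^k − 1)`.
[cite: Balaban1985BackgroundPropagators, (3.80)–(3.81) pp.406–407, p.409 l.3–5; Balaban1984PropagatorsI, (1.18) p.20] -/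
theorem norm_QsCubeY_mul_sub_apply_le_range {U V : CfgY 𝔸 i} (hU : ∀ μ x, UnitaryLike (U μ x)) (hV : ∀ μ x, UnitaryLike (V μ x)) {ρ : ℝ} (hρ : 0 ≤ ρ)
    (b : FBondY i)
    (hsmall : ∀ ι : IBondCubeY i q, qsKc i q b ι ≠ 0 → ∀ (ν : Fin (d + 1)) (w : Site (PV d ℓ i.m i.K hd hL) 0),
      supDist (embIter (ι.1.1 : ℕ) ι.1.2.src) w ≤ (d + 2) * ((ℓ + 1) ^ i.k - 1) → ‖(V ν w : 𝔸) - 1‖ ≤ ρ)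
    (B : IBondCubeY i q → 𝔸) :
    ‖(QsCubeY i q (parBY i) (fun μ x => V μ x * U μ x) B - QsCubeY i q (parBY i) U B) b‖ ≤
      2 * (((d + 2) * ((ℓ + 1) ^ i.k - 1) : ℕ) : ℝ) * ρ * ∑ ι, |qsKc i q b ι| * ‖B ι‖ :=
  norm_QsCubeY_mul_sub_apply_le i q hU hV hρ (tdist_of_qKc_ne_zero_le i q) b hsmall B

/-- ★★ **GLOBAL-SMALLNESS FORM FOR `Q_□`**: `‖U′(b) − 1‖ ≤ ρ` at EVERY bond ⟹ `‖(Q_□(U′U)A − Q_□(U)A)(y)‖ ≤ 2(d+2)(L^k − 1)ρ · Σ_b |q^□_y(b)|‖A(b)‖`.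
[cite: Balaban1985BackgroundPropagators, (3.80)–(3.81) pp.406–407] -/
theorem norm_QCubeY_mul_sub_apply_le_of_forall {U V : CfgY 𝔸 i} (hU : ∀ μ x, UnitaryLike (U μ x)) (hV : ∀ μ x, UnitaryLike (V μ x)) {ρ : ℝ} (hρ : 0 ≤ ρ)
    (hsmall : ∀ (ν : Fin (d + 1)) (w : Site (PV d ℓ i.m i.K hd hL) 0), ‖(V ν w : 𝔸) - 1‖ ≤ ρ) (A : FBondY i → 𝔸) (ι : IBondCubeY i q) :
    ‖(QCubeY i q (parBY i) (fun μ x => V μ x * U μ x) A - QCubeY i q (parBY i) U A) ι‖ ≤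
      2 * (((d + 2) * ((ℓ + 1) ^ i.k - 1) : ℕ) : ℝ) * ρ * ∑ b, |qKc i q ι b| * ‖A b‖ :=
  norm_QCubeY_mul_sub_apply_le_range i q hU hV hρ ι (fun ν w _ => hsmall ν w) A

/-- ★★ **GLOBAL-SMALLNESS FORM FOR `Q*_□`**. [cite: Balaban1985BackgroundPropagators, (3.80)–(3.81) pp.406–407] -/
theorem norm_QsCubeY_mul_sub_apply_le_of_forall {U V : CfgY 𝔸 i} (hU : ∀ μ x, UnitaryLike (U μ x)) (hV : ∀ μ x, UnitaryLike (V μ x)) {ρ : ℝ} (hρ : 0 ≤ ρ)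
    (hsmall : ∀ (ν : Fin (d + 1)) (w : Site (PV d ℓ i.m i.K hd hL) 0), ‖(V ν w : 𝔸) - 1‖ ≤ ρ) (B : IBondCubeY i q → 𝔸) (b : FBondY i) :
    ‖(QsCubeY i q (parBY i) (fun μ x => V μ x * U μ x) B - QsCubeY i q (parBY i) U B) b‖ ≤
      2 * (((d + 2) * ((ℓ + 1) ^ i.k - 1) : ℕ) : ℝ) * ρ * ∑ ι, |qsKc i q b ι| * ‖B ι‖ :=
  norm_QsCubeY_mul_sub_apply_le_range i q hU hV hρ b (fun _ _ ν w _ => hsmall ν w) B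

omit [NormOneClass 𝔸] in
/-- the product with the trivial background: `U′·1 = U′`. [cite: Balaban1985BackgroundPropagators, Cor. 3.6 p.408 («with U = 1»), bookkeeping] -/
theorem mul_one_cfg (V : CfgY 𝔸 i) : (fun μ x => V μ x * (1 : CfgY 𝔸 i) μ x) = V := by
  funext μ x
  simp

/-- ★★★ **THE BACKGROUND-`1` FACE FOR `Q_□`** (the instance of the cube road: Cor. 3.6 gauges the background to `1` on `□̃`, and the Sect.-B step is taken at
`U = 1` with the (3.37)-small `U′ = U^u`): for unitary-like `U′` with `‖U′(b′) − 1‖ ≤ ρ` within `ℓ^∞`-distance `(d+2)(L^k − 1)` of the base point of `y`,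
`‖(Q_□(U′)A − Q_□(1)A)(y)‖ ≤ 2(d+2)(L^k − 1)ρ · Σ_b |q^□_y(b)|‖A(b)‖`. [cite: Balaban1985BackgroundPropagators, (3.80)–(3.81) pp.406–407, Cor. 3.6 p.408, Cor. 3.5 p.407] -/
theorem norm_QCubeY_sub_one_apply_le {V : CfgY 𝔸 i} (hV : ∀ μ x, UnitaryLike (V μ x)) {ρ : ℝ} (hρ : 0 ≤ ρ) (ι : IBondCubeY i q)
    (hsmall : ∀ (ν : Fin (d + 1)) (w : Site (PV d ℓ i.m i.K hd hL) 0),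
      supDist (embIter (ι.1.1 : ℕ) ι.1.2.src) w ≤ (d + 2) * ((ℓ + 1) ^ i.k - 1) → ‖(V ν w : 𝔸) - 1‖ ≤ ρ)
    (A : FBondY i → 𝔸) :
    ‖(QCubeY i q (parBY i) V A - QCubeY i q (parBY i) 1 A) ι‖ ≤ 2 * (((d + 2) * ((ℓ + 1) ^ i.k - 1) : ℕ) : ℝ) * ρ * ∑ b, |qKc i q ι b| * ‖A b‖ := by
  have h := norm_QCubeY_mul_sub_apply_le_range i q (U := 1) (fun _ _ => T4RelativeLadder.UnitaryLike.one) hV hρ ι hsmall A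
  rwa [mul_one_cfg] at h

/-- ★★★ **THE BACKGROUND-`1` FACE FOR `Q*_□`**. [cite: Balaban1985BackgroundPropagators, (3.80)–(3.81) pp.406–407, Cor. 3.6 p.408, Cor. 3.5 p.407] -/
theorem norm_QsCubeY_sub_one_apply_le {V : CfgY 𝔸 i} (hV : ∀ μ x, UnitaryLike (V μ x)) {ρ : ℝ} (hρ : 0 ≤ ρ) (b : FBondY i)
    (hsmall : ∀ ι : IBondCubeY i q, qsKc i q b ι ≠ 0 → ∀ (ν : Fin (d + 1)) (w : Site (PV d ℓ i.m i.K hd hL) 0),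
      supDist (embIter (ι.1.1 : ℕ) ι.1.2.src) w ≤ (d + 2) * ((ℓ + 1) ^ i.k - 1) → ‖(V ν w : 𝔸) - 1‖ ≤ ρ)
    (B : IBondCubeY i q → 𝔸) :
    ‖(QsCubeY i q (parBY i) V B - QsCubeY i q (parBY i) 1 B) b‖ ≤ 2 * (((d + 2) * ((ℓ + 1) ^ i.k - 1) : ℕ) : ℝ) * ρ * ∑ ι, |qsKc i q b ι| * ‖B ι‖ := by
  have h := norm_QsCubeY_mul_sub_apply_le_range i q (U := 1) (fun _ _ => T4RelativeLadder.UnitaryLike.one) hV hρ b hsmall B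
  rwa [mul_one_cfg] at h

/-- ★★ **GLOBAL-SMALLNESS, BACKGROUND `1`, BOTH LETTERS** — the shape with no geometry left for the consumer: for unitary-like `U′` with `‖U′(b) − 1‖ ≤ ρ`
at every bond, `|F₂(A; y, ·)|` and `|F₂*(B; b, ·)|` at `U = 1` are bounded by `2(d+2)(L^k − 1)ρ` times the absolute row of the averaging kernel.
[cite: Balaban1985BackgroundPropagators, (3.80)–(3.81) pp.406–407, p.407 l.1–3] -/
theorem norm_QCubeY_QsCubeY_sub_one_apply_le_of_forall {V : CfgY 𝔸 i} (hV : ∀ μ x, UnitaryLike (V μ x)) {ρ : ℝ} (hρ : 0 ≤ ρ)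
    (hsmall : ∀ (ν : Fin (d + 1)) (w : Site (PV d ℓ i.m i.K hd hL) 0), ‖(V ν w : 𝔸) - 1‖ ≤ ρ) :
    (∀ (A : FBondY i → 𝔸) (ι : IBondCubeY i q),
      ‖(QCubeY i q (parBY i) V A - QCubeY i q (parBY i) 1 A) ι‖ ≤ 2 * (((d + 2) * ((ℓ + 1) ^ i.k - 1) : ℕ) : ℝ) * ρ * ∑ b, |qKc i q ι b| * ‖A b‖) ∧
    (∀ (B : IBondCubeY i q → 𝔸) (b : FBondY i),
      ‖(QsCubeY i q (parBY i) V B - QsCubeY i q (parBY i) 1 B) b‖ ≤ 2 * (((d + 2) * ((ℓ + 1) ^ i.k - 1) : ℕ) : ℝ) * ρ * ∑ ι, |qsKc i q b ι| * ‖B ι‖) :=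
  ⟨fun A ι => norm_QCubeY_sub_one_apply_le i q hV hρ ι (fun ν w _ => hsmall ν w) A,
    fun B b => norm_QsCubeY_sub_one_apply_le i q hV hρ b (fun _ _ ν w _ => hsmall ν w) B⟩

end Cube

end

end Literature.MathematicalPhysics.QuantumFieldTheory.Balaban1983to89.B9Eq380CubeLetters
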